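import Summits.KontsevichZagierPeriods.KontsevichZagierPeriods.Theses.WZCosetWall
import Summits.KontsevichZagierPeriods.KontsevichZagierPeriods.Theses.AyoubSpecialisation
import Summits.KontsevichZagierPeriods.KontsevichZagierPeriods.Theorems.VietaFibreKernelFormItemDictionary
import Literature.NumberTheory.Transcendental.KZKernelConjectureForms

/-!
# `SeriesKernel` (stmt-KontsevichZagierPeriods-6872) — line `pi_cut` (crux-strategist ALTERNATIVE line; the live skeleton `birth` is untouched)

Crux (FIXED): `WZCosetWall.SeriesKernel` — Conjecture 1 for the calculus KZ^Σ (four moves + the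
dominated rational-geometric termwise-summation rule), `R`-form: `ker eval ≤ R` for every
Σ-closed subgroup `R ⊇ relations`.

THE CUT (`[π]`-localisation; strategist census D1; Kontsevich–Zagier 2001 §4.1 `P̂ = P[(2πi)⁻¹]`,
Ayoub 2014 Def. 6 / Conj. 7, Huber–Wüstholz 2022 App. A.4): the crux is summit-implied
(`KZKernelConjecture → SeriesKernel`, `relations ≤ R`), and the summit's kernel form is, by the
LANDED dictionary `kernelForm_iff_ayoubPiLocalKernel_and_ayoubPiCancellation`, exactly the pair
of SHARED items of route AyoubSpecialisation:

  (stub 1) `stub_piLocalKernel`   = item stmt-0541 `AyoubPiLocalKernel` VERBATIM — every formal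
           combination of value 0 becomes a relation after `N` multiplications by a pinned product
           `P n r = [unit disc] ⋆ r`: Conjecture 1 LOCALISED AT `[π]`. All the transcendence.
  (stub 2) `stub_piCancellation`  = item stmt-0540 `AyoubPiCancellation` VERBATIM — `P`-multiplication
           reflects relations (`[π]` is a non-zero-divisor on `FormalRep ⧸ relations`).
           Transcendence-free; printed OPEN (H–W 2022 App. A.4).

COMPOSITION `SeriesKernel_of : SeriesKernel` (stubs BY NAME): the dictionary gives
`KZKernelConjecture`, then `relations ≤ R`. No definition introduced; sorries = the two stubs.
The Σ-rule hypothesis of the crux is NOT used: this line is the honest record that no available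
argument uses Σ-closure of `R` to enlarge what is provable about `ker eval` (census §§4–7), and it
DEDUPLICATES the crux's kernel half onto the two items already staffed once for 8–10 routes.
Exactness within the route: `SummationClosure → (SeriesKernel ↔ stub 1 ∧ stub 2)`
(`Cruxes/SeriesKernel/Split.lean`, `StrategyCensus.lean` §3).

Why it dodges the stuck point of `birth`: `birth`'s hard stub `stub_kernelModGammaSector` is item
14233 (Conjecture 1 modulo the Γ-sector; lead verdicts there: open-problem, chain exhausted, then
decomposed by the Ayoub–π split), and `birth`'s Σ-specific stub leans on "telescoping to the k → ∞
anchor", which the census shows is never a dominated instance of the rule (Laplace point). `pi_cut`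
carries the same transcendence in stub 1 but files NOTHING new and shares every landing on
0541/0540 (lines, disproofs, censuses exist for both).

Disproof used: none exists for this item (`ledger crux ls`: Lines/birth only). The children's own
adversary files apply verbatim: `Cruxes/AyoubPiLocalKernel/Disproof.lean`,
`Cruxes/AyoubPiCancellation/Disproof.lean`.

NOT registered with `ledger skeleton check` by this seat (no `--alt` flag exists; registering would
replace the live `birth` registration): a lead may register it at a cycle boundary with
`ledger skeleton check $(ledger crux dir stmt-KontsevichZagierPeriods-6872)/Lines/pi_cut.lean --crux stmt-KontsevichZagierPeriods-6872`.
-/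

set_option linter.dupNamespace false

noncomputable section

namespace Summit.KontsevichZagierPeriods.KontsevichZagierPeriods.Cruxes.SeriesKernel.PiCut

open Literature.NumberTheory.Transcendental
open Summit.KontsevichZagierPeriods.KontsevichZagierPeriods.Theses

/-- **Stub 1 — `π`-local kernel** (= item stmt-KontsevichZagierPeriods-0541 `AyoubPiLocalKernel`,
VERBATIM signature; shared with AyoubSpecialisation / AttractorUnfolding / HurwitzMicroSectors /
LiouvilleUnfolding / MultivaluedCoV / DefinableMoves / HyperbolicBloch / VietaFibre). Conjecture 1
for the effective period ring localised at `[π]`. Why plausibly true: implied by the summit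
(`ayoubPiLocalKernel_of_kernelForm`, landed). Size: open-problem (period-conjecture strength:
Ayoub 2014 Cor. 32; carries `kzConjecture_implies_oddZetaAlgIndep` etc. verbatim). Leans on:
nothing unproved. [Kontsevich–Zagier 2001, §4.1; Ayoub 2014, Def. 6 / Conj. 7] -/
theorem stub_piLocalKernel :
    ∀ (P : ∀ n : ℕ, Literature.NumberTheory.Transcendental.KZ.IntegralRep n → Literature.NumberTheory.Transcendental.KZ.IntegralRep (n + 2)), (∀ (n : ℕ) (r : Literature.NumberTheory.Transcendental.KZ.IntegralRep n), (P n r).domain = {z : Fin (n + 2) → ℝ | z 0 ^ 2 + z 1 ^ 2 ≤ 1 ∧ (fun i : Fin n => z i.succ.succ) ∈ r.domain} ∧ (P n r).integrand = fun z => r.integrand (fun i : Fin n => z i.succ.succ)) → ∀ c : Literature.NumberTheory.Transcendental.KZ.FormalRep, Literature.NumberTheory.Transcendental.KZ.eval c = 0 → ∃ N : ℕ, (⇑(FreeAbelianGroup.lift (fun s : (Σ n, Literature.NumberTheory.Transcendental.KZ.IntegralRep n) => Literature.NumberTheory.Transcendental.KZ.of (P s.1 s.2))))^[N] c ∈ Literature.NumberTheory.Transcendental.KZ.relations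 := by
  sorry

/-- **Stub 2 — `π`-cancellation** (= item stmt-KontsevichZagierPeriods-0540 `AyoubPiCancellation`,
VERBATIM signature; shared with AyoubSpecialisation / KatzTower / AttractorUnfolding /
HurwitzMicroSectors / SpheresForWalls / LiouvilleUnfolding / MultivaluedCoV / HyperbolicBloch /
EulerFormChain / VietaFibre; `⇔ KZ.PiCancellation ⇔ TerasomaMultiplication.BetaCancellation` by
landed dictionaries). Transcendence-free; its motivic shadow (injectivity
`P̃(MM^eff_Nori) → P̃(MM_Nori)`) is printed OPEN. Why plausibly true: implied by the summit
(soundness). Size: XL. Leans on: nothing unproved. [Huber–Wüstholz 2022, App. A.4; Ayoub 2015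
revisited, Rem. 1.3] -/
theorem stub_piCancellation :
    ∀ (P : ∀ n : ℕ, Literature.NumberTheory.Transcendental.KZ.IntegralRep n → Literature.NumberTheory.Transcendental.KZ.IntegralRep (n + 2)), (∀ (n : ℕ) (r : Literature.NumberTheory.Transcendental.KZ.IntegralRep n), (P n r).domain = {z : Fin (n + 2) → ℝ | z 0 ^ 2 + z 1 ^ 2 ≤ 1 ∧ (fun i : Fin n => z i.succ.succ) ∈ r.domain} ∧ (P n r).integrand = fun z => r.integrand (fun i : Fin n => z i.succ.succ)) → ∀ c : Literature.NumberTheory.Transcendental.KZ.FormalRep, FreeAbelianGroup.lift (fun s : (Σ n, Literature.NumberTheory.Transcendental.KZ.IntegralRep n) => Literature.NumberTheory.Transcendental.KZ.of (P s.1 s.2)) c ∈ Literature.NumberTheory.Transcendental.KZ.relations → c ∈ Literature.NumberTheory.Transcendental.KZ.relations := by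
  sorry

/-- **Composition** — the crux BY NAME from the two stubs: the landed `[π]`-dictionary turns the
pair into `KZKernelConjecture` (`VietaFibre.KernelForm` definitionally), and `relations ≤ R` does
the rest; the Σ-closure hypothesis is discarded. No sorry here. [Kontsevich–Zagier 2001, §1.2
Conjecture 1, §4.1] -/
theorem SeriesKernel_of :
    Summit.KontsevichZagierPeriods.KontsevichZagierPeriods.Theses.WZCosetWall.SeriesKernel := by
  have hK : KZKernelConjecture :=
    Summit.KontsevichZagierPeriods.KernelForm.LocaliseAtValuePrime.kernelForm_iff_ayoubPiLocalKernel_and_ayoubPiCancellation.mpr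
      ⟨stub_piLocalKernel, stub_piCancellation⟩
  intro R hR _ c hc
  exact hR (hK c hc)

/-! ### Converse record (sorry-free, over HYPOTHESES, never over the sorried stubs) -/

/-- The summit's kernel form gives stub 1 (a consequence of the summit, used toward the crux).
[folklore] -/
theorem stub₁_of_kzKernelConjecture (h : KZKernelConjecture) : AyoubSpecialisation.AyoubPiLocalKernel :=
  (Summit.KontsevichZagierPeriods.KernelForm.LocaliseAtValuePrime.kernelForm_iff_ayoubPiLocalKernel_and_ayoubPiCancellation.mp h).1

/-- The summit's kernel form gives stub 2. [folklore] -/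
theorem stub₂_of_kzKernelConjecture (h : KZKernelConjecture) : AyoubSpecialisation.AyoubPiCancellation :=
  (Summit.KontsevichZagierPeriods.KernelForm.LocaliseAtValuePrime.kernelForm_iff_ayoubPiLocalKernel_and_ayoubPiCancellation.mp h).2

/-- Within the route the cut is exact: `SummationClosure → SeriesKernel → stub 1 ∧ stub 2`.
[folklore] -/
theorem stubs_of_seriesKernel (hS : WZCosetWall.SummationClosure) (hK : WZCosetWall.SeriesKernel) :
    AyoubSpecialisation.AyoubPiLocalKernel ∧ AyoubSpecialisation.AyoubPiCancellation :=
  Summit.KontsevichZagierPeriods.KernelForm.LocaliseAtValuePrime.kernelForm_iff_ayoubPiLocalKernel_and_ayoubPiCancellation.mp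
    (fun c hc => hK KZ.relations le_rfl hS c hc)

end Summit.KontsevichZagierPeriods.KontsevichZagierPeriods.Cruxes.SeriesKernel.PiCut

end
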